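import Summits.CriticalPhenomena.SAWScalingLimit.Theses.SAWThetaPercolation

/-!
# Birth skeleton (BC3) for the crux `SAWThetaPercolation.BelowThetaContinuity`
(crux item stmt-CriticalPhenomena-17997, rank 4 of `route-CriticalPhenomena-SAWThetaPercolation`;
skeleton registrar planner-skel-stmt-CriticalPhenomena-17997-0, 2026-08-17; tree path
`Summits/CriticalPhenomena/SAWScalingLimit/Cruxes/BelowThetaContinuity/Lines/birth.lean`.)

Crux (FIXED, by name): `BelowThetaContinuity := WindowSLE → OneClassBelowTheta` — NO TRANSITION BELOW Θ′:
if along some schedule `ω(δ) ↑ 2`, `x(δ)` the contact-fugacity interfaces `𝔓_{x(δ),ω(δ)}` on `δℍ` converge in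
law to chordal SLE_{8/3} in every Dobrushin domain (every hexagonal endpoint approximation), then there is a
critical curve `xc` on `[1,2)` with `xc 1 = 1/√(2+√2)` along which `𝔓_{xc ω, ω}` converges to chordal
SLE_{8/3} for EVERY fixed `ω ∈ [1,2)` (the target `OneClassBelowTheta`, containing Duminil-Copin–Smirnov
Conjecture 1 at `ω = 1`).

## The line `birth`: WINDOW → NEAR-Θ′ INTERVAL → WHOLE DILUTE INTERVAL, ANCHORED AT ω = 1 (3 registered stubs)

This is the route's own TWO-LAYER PLAN for the crux ("BelowThetaContinuity ⇐ WindowToInterval (leave the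
window to fixed ω ∈ [ω₀,2)) → IntervalToAll (no multicritical point down to ω = 1)"), typed, with the
identification of the end-point `xc 1 = x_c(ℍ)` separated out as its own lemma (it is a statement about the
OFF-CRITICAL phases of the plain hexagonal SAW, of a different kind and size than the two universality stubs):

* S1 `stub_windowToInterval` (OPEN, XL; crossover out of the Θ′ window): `WindowToInterval` — the window
  hypothesis of the crux implies that for some `ω₀ ∈ [1,2)` and EVERY FIXED `ω ∈ [ω₀,2)` there is a fugacity
  `x` at which the `(x, ω)` interfaces converge to chordal SLE_{8/3} in every Dobrushin domain.  Mechanism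
  (near-critical percolation technology read backwards): at fixed `ω < 2` the effective distance from Θ′ at
  mesh `δ` is `(2 − ω) δ^{-3/4} → ∞`, deeper in the off-Θ′ regime than any window schedule; if the window
  already shows the dilute (SLE_{8/3}) behaviour, stability of the unpinched phase carries it to fixed `ω`.
* S2 `stub_intervalToAll` (OPEN, XL; the HARDEST stub — universality along the critical line): `IntervalToAll`
  — if SLE_{8/3} convergence holds at some fugacity for every `ω` in a left neighbourhood `[ω₀, 2)` of Θ′, it
  holds at some fugacity for every `ω ∈ [1, 2)`: no multicritical point and no first-order stretch of
  `x_c(ω)` strictly between the SAW (`ω = 1`) and Θ′ (`ω = 2`) — irrelevance of the contact operator at the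
  dilute fixed point (DuplantierSaleur1987, BloteNienhuis1989, VernierJacobsenSaleur2015 numerics: ν = 3/4
  throughout `ω < 2`).
* S3 `stub_anchorAtOne` (L; provable in kind — its ℤ² supercritical half IS in the tree): `AnchorAtOne` — at
  `ω = 1` (where `1^K = 1` makes `𝔓_{x,1}` the plain fugacity-`x` hexagonal SAW law) the ONLY fugacity at which
  the interfaces can converge to chordal SLE_{8/3} in every Dobrushin domain for every endpoint approximation
  is `x = x_c(ℍ) = 1/√(2+√2)`: `x > x_c` is space-filling (Duminil-Copin–Kozma–Yadin 2014, Theorem 1; in tree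
  for `ℤ²` as `Literature.Barriers.CriticalPhenomena.SupercriticalSAW.DKY2014_thm1_holds` and
  `not_convergesInLawToSLE_supercritical_unitDisc_of_lt_eight` — port to `ℍ`), `0 < x < x_c` is
  ballistic/sub-diffusive-free (mass gap `x μ(ℍ) < 1`, `HexSAWBridges.hexConnectiveConstant_mul_lt_one`;
  Ornstein–Zernike: the bridge concentrates on the geodesic, a deterministic curve, not SLE_{8/3}), and
  `x ≤ 0` gives a junk law (zero, or supported on one parity class of `ℓ(γ)` on the bipartite lattice ℍ, hence
  zero for endpoint approximations of the other parity) which converges to nothing.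

Composition (kernel-checked, sorry-free; `BelowThetaContinuity_of`): given the window hypothesis `hW`, S1 then
S2 give `∀ ω ∈ [1,2), ∃ x, ConvSLE x ω`; choose `xc ω` by `Classical.choose` on `[1,2)` (junk `0` outside);
`ConvSLE (xc 1) 1` and S3 force `xc 1 = hexCriticalFugacity`; this is `OneClassBelowTheta` (the unfolding
`BelowThetaContinuity ↔ (WindowSLE → Target)` and `OneClassBelowTheta ↔ Target` are `Iff.rfl`: the local
`isawLaw`/`ConvSLE` are the route's inlined `let`s verbatim).

Honesty w.r.t. the refuter's birth attack (item evidence ATTACK.md, 2026-08-17): "crux → target only via H" —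
the window hypothesis H is consumed by S1 and nowhere else; no stub restates the target (S2 concludes only
pointwise existence of good fugacities, without the anchor; S3 is a uniqueness statement at ω = 1 that does not
assert any convergence).  `Disproof.lean`: none exists for this crux (ledger crux ls, 2026-08-17).  Negatives
index (11 refuted statements, 2026-08-17): none concerns the contact-fugacity family, universality in ω, or
off-critical fugacities; no all-δ tightness (stmt-0772) and no observable (stmt-5420/8312) appears in any stub.

BC3 AUDIT and PROBES: see the registrar's NOTES.md / the line card `Lines/birth.md` (lean check rc 0, sorries =
the three `stub_*`, zero elsewhere; for each of `WindowToInterval`, `IntervalToAll`, `AnchorAtOne` the probes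
`→ BelowThetaContinuity` and `→ _root_.SAWScalingLimit` by `first | exact? | simpa [Def] | (unfold Def; simpa) |
aesop` and by each alternative separately all FAIL).
-/

noncomputable section

namespace Summit.CriticalPhenomena.SAWScalingLimit.Cruxes.BelowThetaContinuity.Birth

open MeasureTheory Filter Topology Set
open scoped NNReal ENNReal Classical
open Literature.Probability.LatticeModels
open Literature.Probability.RandomPlanarGeometry
open Summit.CriticalPhenomena.SAWScalingLimit.Theses.SAWThetaPercolation (OneClassBelowTheta)

set_option linter.unusedVariables false

/-! ## 1. The route's inlined objects, by name (verbatim the `let`s of the route decls) -/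

/-- The **contact-fugacity law** `𝔓_{x,ω}` on SAWs of `Ω_δ ⊆ δℍ` from `a` to `b`: `γ` gets weight
`x^{V(γ)} ω^{K(γ)}`, `V` = number of vertices, `K = V − N`, `N` = number of hexagons bordering an edge of `γ`;
normalised (junk `0`).  Verbatim the `let isawLaw` of `OneClassBelowTheta` / `ThetaWindowLimit` /
`BelowThetaContinuity`. -/
def isawLaw (Ω : Set ℂ) (δ x ω : ℝ) (a b : HexVertex) : Measure (SAW.HexDomainSAW Ω δ a b) :=
  let w : Measure (SAW.HexDomainSAW Ω δ a b) :=
    Measure.sum (fun γ : SAW.HexDomainSAW Ω δ a b =>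
      ENNReal.ofReal (x ^ γ.vertexCount * ω ^ (γ.vertexCount -
        (γ.walk.darts.toFinset.biUnion (fun d => hexFaceVertices d.fst ∩ hexFaceVertices d.snd)).card)) •
        Measure.dirac γ)
  (w Set.univ)⁻¹ • w

/-- **`ConvSLE x ω`**: at the FIXED parameters `(x, ω)`, for every Dobrushin domain and every hexagonal endpoint
approximation the `𝔓_{x,ω}` interface converges in law (curves modulo reparametrisation) to chordal SLE_{8/3}. -/
def ConvSLE (x ω : ℝ) : Prop :=
  ∀ (D : DobrushinDomain) (a b : ℝ → HexVertex), SAW.IsEmbEndpointApprox hexGraph hexCenter D a b →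
    ConvergesInLawToSLE ((8 : NNReal) / 3) D (fun δ (γ : SAW.HexDomainSAW D.carrier δ (a δ) (b δ)) => γ.curve)
      (fun δ => isawLaw D.carrier δ x ω (a δ) (b δ))

/-- **`WindowSLE`** — the hypothesis of the crux: along some schedule `ω(δ) → 2`, `ω(δ) < 2` eventually, with
fugacities `x(δ)`, the `𝔓_{x(δ),ω(δ)}` interfaces converge in law to chordal SLE_{8/3} in every Dobrushin domain. -/
def WindowSLE : Prop :=
  ∃ ωs xs : ℝ → ℝ, Tendsto ωs (𝓝[>] (0 : ℝ)) (𝓝 2) ∧ (∀ᶠ δ in 𝓝[>] (0 : ℝ), ωs δ < 2) ∧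
    ∀ (D : DobrushinDomain) (a b : ℝ → HexVertex), SAW.IsEmbEndpointApprox hexGraph hexCenter D a b →
      ConvergesInLawToSLE ((8 : NNReal) / 3) D (fun δ (γ : SAW.HexDomainSAW D.carrier δ (a δ) (b δ)) => γ.curve)
        (fun δ => isawLaw D.carrier δ (xs δ) (ωs δ) (a δ) (b δ))

/-- **`Target`** — the route target `OneClassBelowTheta` in the local vocabulary: a critical curve `xc` on `[1,2)`
through `xc 1 = x_c(ℍ)` with `ConvSLE (xc ω) ω` for every `ω ∈ [1,2)`. -/
def Target : Prop :=
  ∃ xc : ℝ → ℝ, xc 1 = SAW.hexCriticalFugacity ∧ ∀ ω ∈ Set.Ico (1 : ℝ) 2, ConvSLE (xc ω) ω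

/-- The target, by name, IS `Target` (definitional: the route decl inlines `isawLaw` as a `let`). -/
theorem oneClassBelowTheta_iff : OneClassBelowTheta ↔ Target := Iff.rfl

/-- The crux, by name, IS `WindowSLE → OneClassBelowTheta` (definitional). -/
theorem belowThetaContinuity_iff :
    Summit.CriticalPhenomena.SAWScalingLimit.Theses.SAWThetaPercolation.BelowThetaContinuity ↔
      (WindowSLE → OneClassBelowTheta) := Iff.rfl

/-! ## 2. Statements of the line -/

/-- **(S1) Window → near-Θ′ interval.**  The window hypothesis implies: for some `ω₀ ∈ [1,2)` and every fixed
`ω ∈ [ω₀, 2)` there is a fugacity `x` with `ConvSLE x ω`. -/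
def WindowToInterval : Prop :=
  WindowSLE → ∃ ω₀ ∈ Set.Ico (1 : ℝ) 2, ∀ ω ∈ Set.Ico ω₀ 2, ∃ x : ℝ, ConvSLE x ω

/-- **(S2) Near-Θ′ interval → the whole dilute interval.**  If every `ω` in a left neighbourhood `[ω₀, 2)` of Θ′
carries a fugacity with `ConvSLE`, then so does every `ω ∈ [1, 2)` (no transition strictly below Θ′). -/
def IntervalToAll : Prop :=
  (∃ ω₀ ∈ Set.Ico (1 : ℝ) 2, ∀ ω ∈ Set.Ico ω₀ 2, ∃ x : ℝ, ConvSLE x ω) →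
    ∀ ω ∈ Set.Ico (1 : ℝ) 2, ∃ x : ℝ, ConvSLE x ω

/-- **(S3) Anchor at ω = 1.**  For the plain hexagonal SAW (`ω = 1`), SLE_{8/3} convergence in every Dobrushin
domain for every endpoint approximation forces the fugacity to be critical: `x = x_c(ℍ) = 1/√(2+√2)`. -/
def AnchorAtOne : Prop :=
  ∀ x : ℝ, ConvSLE x 1 → x = SAW.hexCriticalFugacity

/-! ## 3. Registered stubs (`sorry` only here) -/

/-- **S1 `stub_windowToInterval`** — `WindowToInterval` (OPEN, XL: crossover out of the near-Θ′ window to fixed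
contact fugacity; GarbanPeteSchramm2013Pivotal / GarbanPeteSchramm2018 / Nolin2008-type stability read at the
`λ → ∞` end).  Why it might fail: non-commuting limits (δ → 0 along the window vs. fixed ω), i.e. the window
may see SLE_{8/3} while fixed ω near 2 sits on a first-order stretch of `x_c(ω)`. -/
theorem stub_windowToInterval : WindowToInterval := by
  sorry

/-- **S2 `stub_intervalToAll`** — `IntervalToAll` (OPEN, XL, HARDEST: universality of the interface law along the
critical curve `x_c(ω)`, `1 ≤ ω < 2`, with no monotone coupling in `ω`; DuplantierSaleur1987, BloteNienhuis1989,
VernierJacobsenSaleur2015).  Why it might fail: an intermediate multicritical point on `(1, ω₀)`. -/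
theorem stub_intervalToAll : IntervalToAll := by
  sorry

/-- **S3 `stub_anchorAtOne`** — `AnchorAtOne` (L: the hexagonal port of Duminil-Copin–Kozma–Yadin 2014 Thm 1 —
in tree for ℤ² as `Literature.Barriers.CriticalPhenomena.SupercriticalSAW.DKY2014_thm1_holds`,
`not_convergesInLawToSLE_supercritical_unitDisc_of_lt_eight` — for `x > x_c`; the subcritical mass gap
`HexSAWBridges.hexConnectiveConstant_mul_lt_one` + Ornstein–Zernike ballisticity for `0 < x < x_c`; parity /
zero-law junk for `x ≤ 0`).  Why it might fail: only through a mis-typing of the junk regimes — mathematically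
the off-critical hexagonal SAW is not SLE_{8/3}. -/
theorem stub_anchorAtOne : AnchorAtOne := by
  sorry

/-! ### Name-keyed aliases of the three statements — the hypotheses of `BelowThetaContinuity_of`

The skeleton audit (`#h21_check_skeleton`) admits a hypothesis of the skeleton theorem only if its head constant
is a registered obligation or is NAMED like a declared stub; `__Registered.stub_X` is the statement of `stub_X`
under that name (device of `Cruxes/ArrivalFlattening/Lines/birth.lean`, `Cruxes/CriticalCurveContinuity/…`).
Each alias is definitionally its statement. -/
namespace __Registered

/-- Alias of `WindowToInterval` keyed by the registered stub name. -/
abbrev stub_windowToInterval : Prop := WindowToInterval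
/-- Alias of `IntervalToAll` keyed by the registered stub name. -/
abbrev stub_intervalToAll : Prop := IntervalToAll
/-- Alias of `AnchorAtOne` keyed by the registered stub name. -/
abbrev stub_anchorAtOne : Prop := AnchorAtOne

end __Registered

/-! ## 4. The sorry-free part: the composition -/

/-- Pointwise good fugacities on `[1,2)` plus the anchor give the target (choice of `xc`). -/
theorem target_of_pointwise (hall : ∀ ω ∈ Set.Ico (1 : ℝ) 2, ∃ x : ℝ, ConvSLE x ω) (hA : AnchorAtOne) :
    Target := by
  have h1 : (1 : ℝ) ∈ Set.Ico (1 : ℝ) 2 := ⟨le_rfl, by norm_num⟩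
  refine ⟨fun ω => if h : ω ∈ Set.Ico (1 : ℝ) 2 then (hall ω h).choose else 0, ?_, ?_⟩
  · simp only [dif_pos h1]
    exact hA _ (hall 1 h1).choose_spec
  · intro ω hω
    simp only [dif_pos hω]
    exact (hall ω hω).choose_spec

/-! ## 5. The skeleton theorem: the three stubs imply the crux, BY NAME -/

/-- **`BelowThetaContinuity` from the line `birth`** (kernel-checked, no `sorry` of its own): hypotheses = the
three stubs under their registered names; conclusion = the route decl, by name.  Window `hW` —S1→ good
fugacities on `[ω₀,2)` —S2→ on `[1,2)` —S3 + choice→ a critical curve through `x_c(ℍ)` = `OneClassBelowTheta`. -/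
theorem BelowThetaContinuity_of (h1 : __Registered.stub_windowToInterval)
    (h2 : __Registered.stub_intervalToAll) (h3 : __Registered.stub_anchorAtOne) :
    Summit.CriticalPhenomena.SAWScalingLimit.Theses.SAWThetaPercolation.BelowThetaContinuity := by
  rw [belowThetaContinuity_iff]
  intro hW
  rw [oneClassBelowTheta_iff]
  exact target_of_pointwise (h2 (h1 hW)) h3

/-- Wiring check (an `example`, so that `BelowThetaContinuity_of` stays the only theorem concluding the crux):
the registered stubs, with their stated types, feed the skeleton theorem — this term becomes the crux proof when
the three `sorry`s above are discharged. -/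
example : Summit.CriticalPhenomena.SAWScalingLimit.Theses.SAWThetaPercolation.BelowThetaContinuity :=
  BelowThetaContinuity_of stub_windowToInterval stub_intervalToAll stub_anchorAtOne

/-! ## 6. Sorry-free sanity theorems (not used by the skeleton theorem) -/

/-- The converse direction of the cut is free: the target gives S2's conclusion and S1's conclusion outright
(so S1/S2 are CONSEQUENCES of the target used TOWARD it — the honest shape of a universality line). -/
theorem pointwise_of_target (hT : Target) : ∀ ω ∈ Set.Ico (1 : ℝ) 2, ∃ x : ℝ, ConvSLE x ω := by
  obtain ⟨xc, -, hxc⟩ := hT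
  exact fun ω hω => ⟨xc ω, hxc ω hω⟩

/-- … and the target with the crux's hypothesis discharged trivially gives the crux (target → crux is
modus-ponens-free, as the refuter's birth attack recorded; an `example`, so that `BelowThetaContinuity_of`
stays the only theorem of this file concluding the crux by name). -/
example (hT : Target) :
    Summit.CriticalPhenomena.SAWScalingLimit.Theses.SAWThetaPercolation.BelowThetaContinuity := by
  rw [belowThetaContinuity_iff, oneClassBelowTheta_iff]
  exact fun _ => hT

end Summit.CriticalPhenomena.SAWScalingLimit.Cruxes.BelowThetaContinuity.Birth

end
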